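import Literature.Geometry.Kaehler.ComplexTorusTypeOfPolarization
import HarnessLib

/-!
# The type of a polarisation is preserved by a rational similitude of the lattice form

Topic `Literature/Geometry/Kaehler` (complex tori; companion of `ComplexTorusTypeOfPolarization`,
`ComplexTorusPolarizationType`, `ComplexTorusPolarizationTypeAnyBasis`).  THEOREMS ONLY (no definition, no
named fact, no instance).  Cell `hodgecm-mathlib`, Hecke-link socket H2c, brick LACK-1 of B-p03 (g15)'s census
`CENSUS-H2c-HasTypeLattice` (B-plan1 (g14) ruling 2026-08-29T19:31:36Z (4)): the pure symplectic-lattice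
arithmetic behind «the polarisation descended through the Hecke kernel `K₀ = h⁻¹L/L` has type EXACTLY `δ`».

Setting: `X = E/Φ(ℤ^ι)` a complex torus with a real `2`-form `ω` of type `d = (d₁, …, d_g)` on its lattice
(★ `ComplexTorus.IsPolarizationType`: a symplectic lattice basis in which the lattice form `E_Λ(x, y) = ω(Φx, Φy)`
is `(0 D; -D 0)`), and `h : ℝ^ι ≃ ℝ^ι` a SIMILITUDE of the lattice form of multiplier `ν`:
`ω(Φ(hx), Φ(hy)) = ν · ω(Φx, Φy)` (it suffices to know this on integer vectors).  The torus
`X₁ = E/Φ(h⁻¹ℤ^ι)` (lattice parametrisation `Φ ∘ h⁻¹ = h.symm.trans Φ`; when `h` is integral, `Φ(h⁻¹ℤ^ι) ⊇ Φ(ℤ^ι)`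
and `X₁ = X/K₀`, `K₀ = h⁻¹ℤ^ι/ℤ^ι`) carries the form `ν • ω`, and

* `IsPolarizationType.of_forall_intVec_eq`, `…of_latticeGram_eq`, `isPolarizationType_iff_of_latticeGram_eq` — the type
  depends only on the lattice form `(m, n) ↦ ω(Φm, Φn)` on `ℤ^ι × ℤ^ι` (resp. on its Gram matrix ★ `latticeGram`):
  two lattice parametrisations with the same lattice form have the same types (SAME symplectic basis);
* `apply_comp_eq_mul_of_forall_intVec` — a similitude relation on integer vectors holds on all of `ℝ^ι` (two real
  bilinear forms agreeing on the standard basis);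
* **`IsPolarizationType.of_similitude`** — `ν • ω` is of type `d` on the lattice `Φ(h⁻¹ℤ^ι)`: its lattice form in the
  parametrisation `Φ ∘ h⁻¹` IS the lattice form of `ω` (`ν ω(Φh⁻¹x, Φh⁻¹y) = ω(Φx, Φy)`), so the type-`d` basis of
  `(Φ, ω)` serves — [Lange2023AbelianVarietiesComplex] §1.5.1 (the type is the vector of elementary divisors of `E_Λ`,
  hence an invariant of the isometry class of the integral alternating form), §2.7 / [MumfordAV1970] §23
  (descent of a line bundle / polarisation through a finite subgroup: `L = f^*M`);
* **`IsRiemannForm.of_similitude`** — for `ν > 0` and `ω` a Riemann form for `X`, `ν • ω` is a Riemann form for `X₁`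
  (type `(1,1)` and positivity scale by `ν`; integrality on `Φ(h⁻¹ℤ^ι)` is integrality of `ω` on `Φ(ℤ^ι)`);
* `IsRiemannForm.polarizationType_of_similitude` — hence the canonical types agree:
  `(ν • ω).polarizationType = ω.polarizationType` (★ `IsPolarizationType.eq_polarizationType`).

## References

* [Lange2023AbelianVarietiesComplex] H. Lange, *Abelian Varieties over the Complex Numbers*, Springer (2023), §1.5.1
  (type of a polarisation, elementary divisors, p. 46) and §2.7 (isogenies and polarisations).
* [MumfordAV1970] D. Mumford, *Abelian Varieties* (1970), §23 (descent of line bundles to `X/K`, `K(L)` and the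
  behaviour of polarisations under isogenies).

#harness_tags hodge_theory.polarizations, algebraic_geometry.abelian_varieties
-/

noncomputable section

open Module

namespace Literature.Geometry.Kaehler

namespace ComplexTorus

variable {ι : Type*} {E E' : Type*} [NormedAddCommGroup E] [NormedSpace ℂ E] [NormedAddCommGroup E']
  [NormedSpace ℂ E'] {Φ : (ι → ℝ) ≃L[ℝ] E} {ω : E [⋀^Fin 2]→L[ℝ] ℝ} {Φ' : (ι → ℝ) ≃L[ℝ] E'}
  {ω' : E' [⋀^Fin 2]→L[ℝ] ℝ} {g : ℕ} {d : Fin g → ℕ}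

/-! ### §1 The type depends only on the lattice form -/

/-- **Two lattice parametrisations with the same lattice form on integer vectors have the same types**: if
`ω′(Φ′m, Φ′n) = ω(Φm, Φn)` for all `m, n ∈ ℤ^ι`, a symplectic basis of type `d` for `(Φ, ω)` is one for
`(Φ′, ω′)`. [cite: Lange2023AbelianVarietiesComplex, §1.5.1 (p. 46)] -/
theorem IsPolarizationType.of_forall_intVec_eq (hd : IsPolarizationType Φ ω d)
    (h : ∀ m n : ι → ℤ, ω' ![Φ' (intVec m), Φ' (intVec n)] = ω ![Φ (intVec m), Φ (intVec n)]) :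
    IsPolarizationType Φ' ω' d := by
  obtain ⟨hchain, b, huu, hvv, huv⟩ := hd
  exact ⟨hchain, b, fun i j ↦ by rw [h]; exact huu i j, fun i j ↦ by rw [h]; exact hvv i j,
    fun i j ↦ by rw [h]; exact huv i j⟩

variable [Fintype ι] [DecidableEq ι]

/-- Equal Gram matrices on the lattice basis give equal lattice forms on ALL real vectors (`ω(Φx, Φy) = ᵗx G y`,
★ `dotProduct_latticeGram_mulVec`). [cite: Lange2023AbelianVarietiesComplex, §1.5.1 (p. 46)] -/
theorem apply_eq_of_latticeGram_eq (hG : latticeGram Φ' ω' = latticeGram Φ ω) (x y : ι → ℝ) :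
    ω' ![Φ' x, Φ' y] = ω ![Φ x, Φ y] := by
  rw [← dotProduct_latticeGram_mulVec, ← dotProduct_latticeGram_mulVec, hG]

/-- **Same Gram matrix ⇒ same types.** [cite: Lange2023AbelianVarietiesComplex, §1.5.1 (p. 46)] -/
theorem IsPolarizationType.of_latticeGram_eq (hd : IsPolarizationType Φ ω d)
    (hG : latticeGram Φ' ω' = latticeGram Φ ω) : IsPolarizationType Φ' ω' d :=
  hd.of_forall_intVec_eq fun _ _ ↦ apply_eq_of_latticeGram_eq hG _ _

/-- Same Gram matrix ⇒ the SAME set of types. [cite: Lange2023AbelianVarietiesComplex, §1.5.1 (p. 46)] -/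
theorem isPolarizationType_iff_of_latticeGram_eq (hG : latticeGram Φ' ω' = latticeGram Φ ω) :
    IsPolarizationType Φ' ω' d ↔ IsPolarizationType Φ ω d :=
  ⟨fun hd ↦ hd.of_latticeGram_eq hG.symm, fun hd ↦ hd.of_latticeGram_eq hG⟩

/-! ### §2 Similitudes of the lattice form -/

/-- **A similitude relation on integer vectors holds everywhere**: if `ω(Φ(hm), Φ(hn)) = ν ω(Φm, Φn)` for all
`m, n ∈ ℤ^ι`, then `ω(Φ(hx), Φ(hy)) = ν ω(Φx, Φy)` for all `x, y ∈ ℝ^ι` — two real bilinear forms (★ `latticeBilin`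
of `Φ ∘ h` and `ν •` that of `Φ`) agreeing on the standard basis `eᵢ = intVec (single i 1)`.
[cite: Lange2023AbelianVarietiesComplex, §1.5.1 (p. 46)] -/
theorem apply_comp_eq_mul_of_forall_intVec (h : (ι → ℝ) ≃L[ℝ] (ι → ℝ)) (ν : ℝ)
    (hsim : ∀ m n : ι → ℤ, ω ![Φ (h (intVec m)), Φ (h (intVec n))] = ν * ω ![Φ (intVec m), Φ (intVec n)])
    (x y : ι → ℝ) : ω ![Φ (h x), Φ (h y)] = ν * ω ![Φ x, Φ y] := by
  have key : latticeBilin (h.trans Φ) ω = ν • latticeBilin Φ ω := by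
    refine LinearMap.BilinForm.ext_basis (Pi.basisFun ℝ ι) fun i j ↦ ?_
    rw [LinearMap.smul_apply, LinearMap.smul_apply, latticeBilin_apply, latticeBilin_apply, Pi.basisFun_apply,
      Pi.basisFun_apply, ContinuousLinearEquiv.trans_apply, ContinuousLinearEquiv.trans_apply,
      ← intVec_single, ← intVec_single, smul_eq_mul]
    exact hsim _ _
  have hxy := LinearMap.BilinForm.congr_fun key x y
  rw [LinearMap.smul_apply, LinearMap.smul_apply, latticeBilin_apply, latticeBilin_apply,
    ContinuousLinearEquiv.trans_apply, ContinuousLinearEquiv.trans_apply, smul_eq_mul] at hxy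
  exact hxy

/-- **The lattice form of `(Φ ∘ h⁻¹, ν • ω)` IS that of `(Φ, ω)`**: `ν ω(Φh⁻¹x, Φh⁻¹y) = ω(Φx, Φy)` for a
similitude `h` of multiplier `ν`. [cite: Lange2023AbelianVarietiesComplex, §1.5.1 (p. 46)] -/
theorem smul_apply_symm_trans_eq_of_forall_intVec (h : (ι → ℝ) ≃L[ℝ] (ι → ℝ)) (ν : ℝ)
    (hsim : ∀ m n : ι → ℤ, ω ![Φ (h (intVec m)), Φ (h (intVec n))] = ν * ω ![Φ (intVec m), Φ (intVec n)])
    (x y : ι → ℝ) : (ν • ω) ![(h.symm.trans Φ) x, (h.symm.trans Φ) y] = ω ![Φ x, Φ y] := by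
  rw [ContinuousAlternatingMap.smul_apply, ContinuousLinearEquiv.trans_apply, ContinuousLinearEquiv.trans_apply,
    smul_eq_mul, ← apply_comp_eq_mul_of_forall_intVec h ν hsim, ContinuousLinearEquiv.apply_symm_apply,
    ContinuousLinearEquiv.apply_symm_apply]

/-- **The type is preserved by a similitude of the lattice form** («`(L₁, νE_δ) ≅_h (L, E_δ)`»): if `ω` is of
type `d` on the lattice `Φ(ℤ^ι)` and `h : ℝ^ι ≃ ℝ^ι` satisfies `ω(Φ(hm), Φ(hn)) = ν ω(Φm, Φn)` on integer
vectors, then `ν • ω` is of type `d` on the lattice `Φ(h⁻¹ℤ^ι)` (parametrisation `Φ ∘ h⁻¹ = h.symm.trans Φ`) —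
with the SAME symplectic basis.  For `h` integral this is the lattice `L₁ = h⁻¹L ⊇ L` of the quotient torus
`X/K₀`, `K₀ = L₁/L`, and `ν • ω` the form of the polarisation descended through `K₀`
([MumfordAV1970] §23; [Lange2023AbelianVarietiesComplex] §2.7). No integrality or positivity hypothesis
is needed for the type statement itself. [cite: Lange2023AbelianVarietiesComplex, §1.5.1 (p. 46)]
[cite: MumfordAV1970, §23 (descent of line bundles to X/K)] -/
theorem IsPolarizationType.of_similitude (hd : IsPolarizationType Φ ω d) (h : (ι → ℝ) ≃L[ℝ] (ι → ℝ)) (ν : ℝ)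
    (hsim : ∀ m n : ι → ℤ, ω ![Φ (h (intVec m)), Φ (h (intVec n))] = ν * ω ![Φ (intVec m), Φ (intVec n)]) :
    IsPolarizationType (h.symm.trans Φ) (ν • ω) d :=
  hd.of_forall_intVec_eq fun _ _ ↦ smul_apply_symm_trans_eq_of_forall_intVec h ν hsim _ _

/-- **A positive multiple of a Riemann form, read on the lattice `Φ(h⁻¹ℤ^ι)` of a similitude `h` of multiplier
`ν > 0`, is a Riemann form**: the `(1,1)`-condition and positivity scale by `ν`, and `ν • ω` is integral on
`Φ(h⁻¹ℤ^ι)` because its lattice form there is the lattice form of `ω` on `Φ(ℤ^ι)`.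
[cite: Lange2023AbelianVarietiesComplex, §1.5.1 (p. 46) and §2.7] [cite: MumfordAV1970, §23 (descent of line bundles to X/K)] -/
theorem IsRiemannForm.of_similitude (hω : IsRiemannForm Φ ω) (h : (ι → ℝ) ≃L[ℝ] (ι → ℝ)) {ν : ℝ} (hν : 0 < ν)
    (hsim : ∀ m n : ι → ℤ, ω ![Φ (h (intVec m)), Φ (h (intVec n))] = ν * ω ![Φ (intVec m), Φ (intVec n)]) :
    IsRiemannForm (h.symm.trans Φ) (ν • ω) := by
  obtain ⟨h11, hint, hpos⟩ := hω
  refine ⟨fun u v ↦ ?_, fun m n ↦ ?_, fun u hu ↦ ?_⟩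
  · rw [ContinuousAlternatingMap.smul_apply, ContinuousAlternatingMap.smul_apply, h11]
  · obtain ⟨k, hk⟩ := hint m n
    exact ⟨k, by rw [smul_apply_symm_trans_eq_of_forall_intVec h ν hsim, hk]⟩
  · rw [ContinuousAlternatingMap.smul_apply, smul_eq_mul]
    exact mul_pos hν (hpos u hu)

/-- **The canonical types agree**: for a Riemann form `ω` and a similitude `h` of multiplier `ν > 0`, the type of
`ν • ω` on `Φ(h⁻¹ℤ^ι)` equals the type of `ω` on `Φ(ℤ^ι)` (★ `IsRiemannForm.polarizationType`, unique by the
elementary divisor theorem ★ `IsPolarizationType.eq_polarizationType`). [cite: Lange2023AbelianVarietiesComplex, §1.5.1 (p. 46)] -/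
theorem IsRiemannForm.polarizationType_of_similitude (hω : IsRiemannForm Φ ω) (h : (ι → ℝ) ≃L[ℝ] (ι → ℝ))
    {ν : ℝ} (hν : 0 < ν)
    (hsim : ∀ m n : ι → ℤ, ω ![Φ (h (intVec m)), Φ (h (intVec n))] = ν * ω ![Φ (intVec m), Φ (intVec n)]) :
    (hω.of_similitude h hν hsim).polarizationType = hω.polarizationType := by
  obtain ⟨hg, hdd⟩ := (hω.isPolarizationType_polarizationType.of_similitude h ν hsim).eq_polarizationType
    (hω.of_similitude h hν hsim)
  funext i
  rw [hdd i]
  exact congrArg _ (Fin.ext rfl)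

end ComplexTorus

end Literature.Geometry.Kaehler

end
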